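import Literature.MathematicalPhysics.QuantumFieldTheory.Balaban1983to89.Node00.Record13SepCoPRInhabitedOfSepCoP
import Literature.MathematicalPhysics.QuantumFieldTheory.Balaban1983to89.Node00.Record13SepCoPLiveSelector
import Literature.MathematicalPhysics.QuantumFieldTheory.Balaban1983to89.Node00.Record13ReverseComparabilityOfBetaBox
import Literature.MathematicalPhysics.QuantumFieldTheory.Balaban1983to89.Node00.Record12BgRowCoClassGauge
import Literature.MathematicalPhysics.QuantumFieldTheory.Balaban1983to89.Node00.Record12BgRowCoClassGaugeRGuardedBRow
import Literature.MathematicalPhysics.QuantumFieldTheory.Balaban1983to89.Node00.LargeFieldBackgroundCoPOfRecordB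

/-!
# NODE 00 (YM-PLAN Track A) — STAGE 13, v1.5 `CoP` ∕ v1.6 `CoPR`: PLAN'S CUT B‴ — THE K0 BODY AT `θ₁₅ᶜᶜ¹` FROM node00-def-P11's TWO [15] SENTENCES (8) `VariationalThm1RegSepCoP7M` AND (9)-LINE-1
# `VariationalThm1GaugeRegSepCoP7M` (FILE 14 `Record12BgRowCoClassGauge`, p532745: the ∃-GAUGE reading, row P11's body ON HANDED-OVER GAUGES, NO axial potential, NO C¹ clause), the β-box and
# the signs — the C¹∕axial letters of Cut A∕B′∕B″ REPLACED by the two RADIUS letters `htI`∕`htMS`, DISCHARGED HERE at `θ₁₅ᶜᶜ¹`; and the same keyed on dag-n07-e's STEP fact `Gauge9RegSepTopStep`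
# (FILE 14 §4 `variationalThm1GaugeRegSepCoP7M_of_gauge9TopStep`: minimal ⇒ critical on the fibre)

Cell `pub-ymgap`, seat `pub-ymgap-node00-def-K0a` (g9), FILE 21 (node00-def-P11 g8 INTENT∕FILED-14: «Cut B‴ = your Cut B″ with `h15C1 ↦ h15G`, the C¹ letters ↦ the two radius letters via
`gaugeLetter_of_numerics`»; dag-n07-e g9 LOCATED-Δ2 is CURED in the landed token — the non-wrapping letter `(side : ℤ) < sitesPerDir 0` guards each cube family, and the composites take `hsN`, which
K0a's 13b-e letter `hsN_theta13OfThm1CC1` discharges).  Same witness family `θ₁₅ᶜᶜ¹ = theta13OfThm1CC1 F N ε₀ ε₂₉ B₃ B₃' a₀ a₁` (13c: `A₀ᶜᶜ¹ = A₀ᶜ∕(1+Λ(L))`, `cB = 6L+1`, `B·C·M_r = 7`,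
`C₀ = 1`, `cR = 1`, `M = M₁ = 1`), same socket 16a, same ⁶ lift (FILE 18 ★★★ `exists_k0SepCoPR_of_exists_k0SepCoP`, cured witness).
[15] = [Balaban1985Variational], [6] = [Balaban1985RegularSpaces], [III] = [Balaban1988Convergent], [I] = [Balaban1987RG1], [IV] = [Balaban1989LargeFieldI].

WHAT THIS FILE PROVES (theorems only; 0 `def`).
§1 THE TWO RADIUS LETTERS AT `θ₁₅ᶜᶜ¹` (FILE 14's «C₀ sufficiently large», same locus as `hBα`): `gauge_mul_A0OfThm1CC1_le` (`B₃′·A₀ᶜᶜ¹ ≤ 1∕192`, from 13c's `Λ(1)·A₀ᶜᶜ¹ ≤ 1∕16` and `12·B₃′ ≤ Λ(1)`),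
   `gauge_mul_A0_nonneg_thm1CC1`, `gauge_mul_A0_le_cB_C₀_thm1CC1` (`B₃′·cR·A₀ ≤ cB·C₀`), `gauge_mul_A0_le_BCM_C₀_thm1CC1` (`≤ B·C·M_r·C₀`), and along every windowed run
   ★ `htI_theta13OfThm1CC1` ∕ ★ `htMS_theta13OfThm1CC1` (`B₃′·(cR·ε_m) ≤ cB·α₀(g_m)` ∕ `≤ B·C·M_r·α₀(g_m)`, `1 ≤ m ≤ n`; FILE 14 `gaugeLetter_of_numerics`).
§2 θ-GENERIC: `Stage13Params.bgAtDatumCoP_of_thm1RegSepCoP7M_of_thm1Gauge (θ) (hθ) (hRz) (hM) (h15) (h15G) (hnum) (ha₀) (hcomp) (hcomp') (hBα) (htI) (htMS) (hC1) (hsN)` — row P11's body AT def-R's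
   collar-class minimiser `UbgMSCoPOfRecord … n s 𝐖` for separated `s`, `0 < M₁`, (7)-data `𝐖`, along windowed partition-compatible runs: ONE application of FILE 14 ★★★
   `bgRowAtDatumCoP_of_thm1RegSepCoP7M_of_thm1Gauge` at `S := settingOfRecord₁₃ F N θ p` (laws∕Pos∕radii from admissibility, (C2) = the antecedent `PartCompat₁₃`; 14g's discipline).
§3 AT `θ₁₅ᶜᶜ¹`: ★★★ `bgSepCoPAt_theta13OfThm1CC1_of_thm1Gauge (signs) (h15) (h15G) (hmono) (hcompRev)` ⊢ 16a's (7)-guarded row-P11 clause `hbgSepCoP` (level `n+1`: `UbgOfRecord₁₃CoP_succ` + §2 with every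
   letter discharged by 13b–e ∕ §1; level `0` vacuous); ★★ `provisos₁₃SepCoP_theta13OfThm1CC1_of_thm1Gauge`.
§4 CLOSERS (`N = 2`): ★★★★★ `exists_k0SepCoP_of_thm1RegSepCoP7M_of_thm1Gauge (F) (signs) (h15) (h15G) (hmono) (hcompRev)` and ★★★★★★ `…_of_betaBox (F) (signs) (h15) (h15G) (hb hlow hup hβ')` ⊢ the ⁵ body;
   their ⁶ images `exists_k0SepCoPR_of_thm1RegSepCoP7M_of_thm1Gauge[_of_betaBox]` (FILE 18 lift, cured witness `⟨θ₁₅ᶜᶜ¹, ZrOfRecord₁₃ …⟩`); and keyed on the STEP fact: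
   ★★★★★★★ `exists_k0SepCoP[R]_of_thm1RegSepCoP7M_of_gauge9TopStep_of_betaBox (h15) (h9 : Gauge9RegSepTopStep F 2 (fun ν K Ω => suppDomOfRecord F ν K Ω) 1 B₃ B₃' a₀ a₁) (hb hlow hup hβ')`.
   With dag-n07-e's `variationalThm1RegSepCoP7M_of_prop8TopStep` (Summits side) the K0⁶ closing term is ONE line over: [15] Prop 8's top step, [15] Sect. F's (9)-step `Gauge9RegSepTopStep`, the β-box of
   `betaOfRecord₁₃ F 2 θ₁₅ᶜᶜ¹`, and the signs `0 < ε₀, 0 < ε₂₉, 0 < B₃, 0 ≤ B₃′, 0 < a₀, 0 < a₁, 0 ≤ b, β′ ≤ 3` — NO C¹ sentence, NO class clause, NO axial letter displayed.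

HONEST FRAMING.  Compositions of tree theorems + two elementary numerics inequalities; CONDITIONAL on the DISPLAYED named facts (`VariationalThm1RegSepCoP7M`, `VariationalThm1GaugeRegSepCoP7M` resp.
`Gauge9RegSepTopStep` — `Prop`s with parameters, NEVER asserted) and on the β-box ∕ history clauses; nothing of Bałaban asserted or discharged; K0⁵∕K0⁶ NOT closed here; counts unmoved (typed 28∕28 ·
discharged 5∕28); one finite 𝕋⁴ programme at fixed ε — NOT continuum ∕ OS ∕ mass gap ∕ Clay.  No `sorry`, `axiom`, `def`, `instance`, `notation`.

STAGE-2 RE-KEY (2026-08-30; (E1) variant (iii-b) of record, director-ym №343 (D5)∕(D6), №345, №350; seat node00-def-K0a g10): «(E1) Stage-2 coherence re-key to print's (2.3) datum (FLAG №16 ∕ LOCATE-HSEAM 5d3298b8d191f169); the (b)-keyed text survives in git history».  After the `Record13CoP` seam re-point `UbgOfRecord₁₃CoP (n+1) = UbgMSCoPOfRecordB …` (node00-def-R) every hypothesis of this file is READ AT PRINT's DATUM, token for token: (8) `VariationalThm1RegSepCoP7M F N B₃ a₀ a₁` ↦ `VariationalThm1RegSepCoP7MGB F N Adm (lamDatum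 F) (dataSmall7PTopOf F N) B₃ a₀ a₁` (k0-s1-w1 S1a-C),
(9)-line-1 `VariationalThm1GaugeRegSepCoP7M F N M B₃ B₃' a₀ a₁` ↦ `VariationalThm1GaugeRegSepCoP7MGB F N M Adm (lamDatum F) (dataSmall7PTopOf F N) B₃ B₃' a₀ a₁` (dag-n07-w2 S1b-2), the step fact
`Gauge9RegSepTopStep F N Sup M …` ↦ `Gauge9RegSepTopStepGB F N Sup M Adm (lamDatum F) (dataSmall7PTopOf F N) …` (S1b-1) with `variationalThm1GaugeRegSepCoP7MGB_of_gauge9TopStepGB` (S1b-2 §3); guard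
`Adm : StepGuard F` GENERIC — an inner antecedent of the θ-generic row §2 (k0-s1-w1 S1b-3's shape) and DISCHARGED per prefix at `θ₁₅ᶜᶜ¹` by the displayed `hAdm` (w1's all-torus convention) in §3–§4;
the background `UbgMSCoPOfRecord` ↦ `UbgMSCoPOfRecordB` with its spec dichotomy `ubgMSCoPOfRecordB_dichotomy` (node00-def-R S2b); FILE 14's row ★★★ `bgRowAtDatumCoP_of_thm1RegSepCoP7M_of_thm1Gauge` ↦
S1b-3's background-generic lift `Stage13Params.bgAtDatumBg_of_thm1RegSepCoP7MGB_of_thm1GaugeGB` instantiated at `Ubg := UbgMSCoPOfRecordB` (w1's `…GuardedBRowLam` ★ names the instance; inlined here,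
that module sits above this file's cone).  IMPORTS re-parented (Stage-2 hygiene, director-ym №351): this file no longer imports `Record13SepCoPInhabitedOfThm1CoP7M(C1)` ∕ the linchpin — it reads
16a's socket, 13b–e∕14d's letters, the HOISTED trunk `Record13SepCoPRInhabitedOfSepCoP` (the ⁶ lift) and the ᴮ rows directly, so its cone (`Record13NumericsOfThm1CCM` → …) does not wait on the
three-module bottom.  Every declaration NAME and every conclusion SHAPE (the socket clause, the K0 bodies) is unchanged; §1 is byte-identical.
-/

noncomputable section

open MeasureTheory
open scoped Matrix.Norms.L2Operator

namespace Literature.MathematicalPhysics.QuantumFieldTheory.Balaban1983to89.Node00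

open T4Continuum B14.Eq218Concrete B15DeterminingSets B15DeterminingSetsB FlowStep FlowStepRuns B12RegularSpaces111 B14RegularSpaces234 B14Radii T4AxialGaugeSmallField

/-! ## §1. The two radius letters of the gauge road at `θ₁₅ᶜᶜ¹` -/

section RadiusLetters

variable {F : T4Family} {N : ℕ} [NeZero N] {ε₀ ε₂₉ B₃ B₃' a₀ a₁ : ℝ}

/-- **`B₃′·A₀ᶜᶜ¹ ≤ 1∕192`** (`12·B₃′ ≤ Λ(1) = 4(B₃ + 3B₃′) + 144·B₃²·a₁` and 13c's `Λ(1)·A₀ᶜᶜ¹ ≤ 1∕16`, `1 ≤ L`). [cite: Balaban1988Convergent, (2.4) p.255, (2.28) p.259 (bookkeeping)] -/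
theorem gauge_mul_A0OfThm1CC1_le {L : ℕ} (hL : 1 ≤ L) (hB : 0 ≤ B₃) (hB' : 0 ≤ B₃') (ha₀ : 0 ≤ a₀) (ha₁ : 0 ≤ a₁) :
    B₃' * A0OfThm1CC1 L B₃ B₃' a₀ a₁ ≤ 1 / 192 := by
  have hΛ := lambda_mul_A0OfThm1CC1_le (Y := (1 : ℝ)) (L := L) zero_le_one (by exact_mod_cast hL) hB hB' ha₀ ha₁
  have hA0 : 0 ≤ A0OfThm1CC1 L B₃ B₃' a₀ a₁ := A0OfThm1CC1_nonneg hB hB' ha₀ ha₁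
  have h12 : 12 * B₃' ≤ lambdaOfThm1CC1 1 B₃ B₃' a₁ := by
    unfold lambdaOfThm1CC1
    nlinarith [sq_nonneg B₃, mul_nonneg (mul_nonneg (sq_nonneg B₃) ha₁) (by norm_num : (0 : ℝ) ≤ 144)]
  nlinarith [mul_le_mul_of_nonneg_right h12 hA0]

/-- `0 ≤ B₃′·cR·A₀` at `θ₁₅ᶜᶜ¹` (`cR = 1`). [cite: Balaban1988Convergent, (2.28) p.259 (bookkeeping)] -/
theorem gauge_mul_A0_nonneg_thm1CC1 (hB : 0 ≤ B₃) (hB' : 0 ≤ B₃') (ha₀ : 0 ≤ a₀) (ha₁ : 0 ≤ a₁) :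
    0 ≤ B₃' * (theta13OfThm1CC1 F N ε₀ ε₂₉ B₃ B₃' a₀ a₁).s2.cR * (theta13OfThm1CC1 F N ε₀ ε₂₉ B₃ B₃' a₀ a₁).ν.A₀ := by
  rw [theta13OfThm1CC1_cR, mul_one, theta13OfThm1CC1_A₀]
  exact mul_nonneg hB' (A0OfThm1CC1_nonneg hB hB' ha₀ ha₁)

/-- **«C₀ sufficiently large» FOR THE I-FAMILY GAUGES**: `B₃′·cR·A₀ ≤ cB·C₀` at `θ₁₅ᶜᶜ¹` (`cB = 6L + 1`, `C₀ = 1`, `cR = 1`; `B₃′·A₀ ≤ 1∕192`). [cite: Balaban1987RG1, (1.12) p.262; Balaban1988Convergent, (2.28) p.259] -/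
theorem gauge_mul_A0_le_cB_C₀_thm1CC1 (hB : 0 ≤ B₃) (hB' : 0 ≤ B₃') (ha₀ : 0 ≤ a₀) (ha₁ : 0 ≤ a₁) :
    B₃' * (theta13OfThm1CC1 F N ε₀ ε₂₉ B₃ B₃' a₀ a₁).s2.cR * (theta13OfThm1CC1 F N ε₀ ε₂₉ B₃ B₃' a₀ a₁).ν.A₀ ≤ (theta13OfThm1CC1 F N ε₀ ε₂₉ B₃ B₃' a₀ a₁).s2.cB * (lfOfRecord₁₂ F N (theta13OfThm1CC1 F N ε₀ ε₂₉ B₃ B₃' a₀ a₁).toStage12Params).C₀ := by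
  rw [theta13OfThm1CC1_cR, mul_one, theta13OfThm1CC1_A₀, theta13OfThm1CC1_cB, lfOfRecord₁₂_theta13OfThm1CC1]
  have h1 : (1 : ℝ) ≤ F.L := by exact_mod_cast F.hL.2.le
  have h := gauge_mul_A0OfThm1CC1_le (L := F.L) F.hL.2.le hB hB' ha₀ ha₁
  norm_num [lfConstsOfFamily, lfConstsOfRecord₁₂]
  nlinarith

/-- **«C₀ sufficiently large» FOR THE MS-FAMILY GAUGES**: `B₃′·cR·A₀ ≤ B·C·M_r·C₀` at `θ₁₅ᶜᶜ¹` (`B·C·M_r = 7`, `C₀ = 1`). [cite: Balaban1988Convergent, (2.38) p.261, (2.28) p.259] -/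
theorem gauge_mul_A0_le_BCM_C₀_thm1CC1 (hB : 0 ≤ B₃) (hB' : 0 ≤ B₃') (ha₀ : 0 ≤ a₀) (ha₁ : 0 ≤ a₁) :
    B₃' * (theta13OfThm1CC1 F N ε₀ ε₂₉ B₃ B₃' a₀ a₁).s2.cR * (theta13OfThm1CC1 F N ε₀ ε₂₉ B₃ B₃' a₀ a₁).ν.A₀ ≤ (theta13OfThm1CC1 F N ε₀ ε₂₉ B₃ B₃' a₀ a₁).s2.B * (theta13OfThm1CC1 F N ε₀ ε₂₉ B₃ B₃' a₀ a₁).s2.C * (theta13OfThm1CC1 F N ε₀ ε₂₉ B₃ B₃' a₀ a₁).s2.Mr * (lfOfRecord₁₂ F N (theta13OfThm1CC1 F N ε₀ ε₂₉ B₃ B₃' a₀ a₁).toStage12Params).C₀ := by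
  rw [theta13OfThm1CC1_cR, mul_one, theta13OfThm1CC1_A₀, theta13OfThm1CC1_B, theta13OfThm1CC1_C, theta13OfThm1CC1_Mr, lfOfRecord₁₂_theta13OfThm1CC1]
  have h := gauge_mul_A0OfThm1CC1_le (L := F.L) F.hL.2.le hB hB' ha₀ ha₁
  norm_num [lfConstsOfFamily, lfConstsOfRecord₁₂]
  linarith

/-- **★ THE I-FAMILY RADIUS LETTER `htI` ALONG EVERY WINDOWED RUN AT `θ₁₅ᶜᶜ¹`**: `B₃′·(cR·ε_m) ≤ cB·α₀(g_m)`, `1 ≤ m ≤ n` (FILE 14 `gaugeLetter_of_numerics`; `0 < g ≤ ½` in the window).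
[cite: Balaban1987RG1, (1.12) p.262; Balaban1988Convergent, (2.4) p.255, (2.28) p.259] -/
theorem htI_theta13OfThm1CC1 (hB : 0 ≤ B₃) (hB' : 0 ≤ B₃') (ha₀ : 0 ≤ a₀) (ha₁ : 0 ≤ a₁) :
    ∀ (p : B12.RunParams) (n : ℕ), n ≤ p.K → Step.InInterval (theta13OfThm1CC1 F N ε₀ ε₂₉ B₃ B₃' a₀ a₁).γ n (gOfRecord₁₃ F N (theta13OfThm1CC1 F N ε₀ ε₂₉ B₃ B₃' a₀ a₁) p) → ∀ m, 1 ≤ m → m ≤ n →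
      B₃' * ((theta13OfThm1CC1 F N ε₀ ε₂₉ B₃ B₃' a₀ a₁).s2.cR * epsOfRecord (theta13OfThm1CC1 F N ε₀ ε₂₉ B₃ B₃' a₀ a₁).ν (gOfRecord₁₃ F N (theta13OfThm1CC1 F N ε₀ ε₂₉ B₃ B₃' a₀ a₁) p) m) ≤
        (theta13OfThm1CC1 F N ε₀ ε₂₉ B₃ B₃' a₀ a₁).s2.cB * (lfOfRecord₁₂ F N (theta13OfThm1CC1 F N ε₀ ε₂₉ B₃ B₃' a₀ a₁).toStage12Params).alpha0 (gOfRecord₁₃ F N (theta13OfThm1CC1 F N ε₀ ε₂₉ B₃ B₃' a₀ a₁) p m) :=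
  fun p n hn hw => gaugeLetter_of_numerics (lfOfRecord₁₂ F N (theta13OfThm1CC1 F N ε₀ ε₂₉ B₃ B₃' a₀ a₁).toStage12Params) (theta13OfThm1CC1 F N ε₀ ε₂₉ B₃ B₃' a₀ a₁).ν
    (fun m _ hm => hg_theta13OfThm1CC1 p n hn hw m hm) hpq_theta13OfThm1CC1 (gauge_mul_A0_nonneg_thm1CC1 hB hB' ha₀ ha₁) (gauge_mul_A0_le_cB_C₀_thm1CC1 hB hB' ha₀ ha₁)

/-- **★ THE MS-FAMILY RADIUS LETTER `htMS` ALONG EVERY WINDOWED RUN AT `θ₁₅ᶜᶜ¹`**: `B₃′·(cR·ε_m) ≤ B·C·M_r·α₀(g_m)`, `1 ≤ m ≤ n`. [cite: Balaban1988Convergent, (2.38) p.261, (2.4) p.255, (2.28) p.259] -/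
theorem htMS_theta13OfThm1CC1 (hB : 0 ≤ B₃) (hB' : 0 ≤ B₃') (ha₀ : 0 ≤ a₀) (ha₁ : 0 ≤ a₁) :
    ∀ (p : B12.RunParams) (n : ℕ), n ≤ p.K → Step.InInterval (theta13OfThm1CC1 F N ε₀ ε₂₉ B₃ B₃' a₀ a₁).γ n (gOfRecord₁₃ F N (theta13OfThm1CC1 F N ε₀ ε₂₉ B₃ B₃' a₀ a₁) p) → ∀ m, 1 ≤ m → m ≤ n →
      B₃' * ((theta13OfThm1CC1 F N ε₀ ε₂₉ B₃ B₃' a₀ a₁).s2.cR * epsOfRecord (theta13OfThm1CC1 F N ε₀ ε₂₉ B₃ B₃' a₀ a₁).ν (gOfRecord₁₃ F N (theta13OfThm1CC1 F N ε₀ ε₂₉ B₃ B₃' a₀ a₁) p) m) ≤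
        (theta13OfThm1CC1 F N ε₀ ε₂₉ B₃ B₃' a₀ a₁).s2.B * (theta13OfThm1CC1 F N ε₀ ε₂₉ B₃ B₃' a₀ a₁).s2.C * (theta13OfThm1CC1 F N ε₀ ε₂₉ B₃ B₃' a₀ a₁).s2.Mr * (lfOfRecord₁₂ F N (theta13OfThm1CC1 F N ε₀ ε₂₉ B₃ B₃' a₀ a₁).toStage12Params).alpha0 (gOfRecord₁₃ F N (theta13OfThm1CC1 F N ε₀ ε₂₉ B₃ B₃' a₀ a₁) p m) :=
  fun p n hn hw => gaugeLetter_of_numerics (lfOfRecord₁₂ F N (theta13OfThm1CC1 F N ε₀ ε₂₉ B₃ B₃' a₀ a₁).toStage12Params) (theta13OfThm1CC1 F N ε₀ ε₂₉ B₃ B₃' a₀ a₁).ν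
    (fun m _ hm => hg_theta13OfThm1CC1 p n hn hw m hm) hpq_theta13OfThm1CC1 (gauge_mul_A0_nonneg_thm1CC1 hB hB' ha₀ ha₁) (gauge_mul_A0_le_BCM_C₀_thm1CC1 hB hB' ha₀ ha₁)

end RadiusLetters

/-! ## §2. θ-generic: row P11's body AT node00-def-R's print-datum background `UbgMSCoPOfRecordB` from the two guarded ᴮ sentences (S1b-3's lift, guard as inner antecedent) -/

section LiftGauge

variable {F : T4Family} {N : ℕ} [NeZero N]

/-- **★ ROW P11's BODY AT `UbgMSCoPOfRecordB … n s 𝐖` AT THE STAGE-13 RECORD FROM THE TWO GUARDED [15] SENTENCES OVER PRINT's (2.3) DATUM** — k0-s1-w1 S1b-3's background-generic lift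
`Stage13Params.bgAtDatumBg_of_thm1RegSepCoP7MGB_of_thm1GaugeGB` at `Ubg := UbgMSCoPOfRecordB …`, `bd := lamDatum F`, `Dat := dataSmall7PTopOf F N`, the background's `lamBondsSeq`-spec dichotomy
`hbg` DISCHARGED by node00-def-R's `ubgMSCoPOfRecordB_dichotomy` (S2b) — laws, `Pos` and the radii `α₀, α₁ > 0` from admissibility in the window, (C2) = the run-level antecedent `PartCompat₁₃ F N θ p n`,
the prefix guard `Adm …` an inner antecedent; the numerics letters displayed per windowed run; for a separated `s`, `0 < M₁`, and a datum `𝐖` with print's (7) on the support.  A REDUCTION — the two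
sentences are hypotheses, never asserted (w1's `…GuardedBRowLam` ★ is the same instance for every `Dat`; it is re-derived here because that module imports this file's cone). [cite: Balaban1985Variational, (6)–(7) p.278, Thm 1 (8)–(9) p.279, (152) p.301, Prop. 8 p.304, p.304 lines 1–2; Balaban1985RegularSpaces, (1.3)–(1.9) p.77; Balaban1984PropagatorsII, (2.3) p.224; Balaban1988Convergent, Thm 1 p.262, (2.4)–(2.8) pp.255–256, (2.12)–(2.13) p.256, (2.27)–(2.28) p.259, (2.34)–(2.41) p.261, (3.16)–(3.22) pp.268–269; Balaban1987RG1, (0.1) p.251, (1.11)–(1.12) p.262; Balaban1989LargeFieldI, (0.3)–(0.4) p.176] -/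
theorem Stage13Params.bgAtDatumCoP_of_thm1RegSepCoP7M_of_thm1Gauge (θ : Stage13Params F N) (hθ : θ.Admissible F N) (hRz : θ.Rz = RzOfRecord F N)
    {Adm : StepGuard F} {B₃ B₃' a₀ a₁ : ℝ} (hM : 0 < θ.τ9.M)
    (h15 : VariationalThm1RegSepCoP7MGB F N Adm (lamDatum F) (dataSmall7PTopOf F N) B₃ a₀ a₁) (h15G : VariationalThm1GaugeRegSepCoP7MGB F N θ.τ9.M Adm (lamDatum F) (dataSmall7PTopOf F N) B₃ B₃' a₀ a₁)
    (hnum : ∀ (p : B12.RunParams) (n : ℕ), n ≤ p.K → Step.InInterval θ.γ n (gOfRecord₁₃ F N θ p) → ∀ m, m ≤ n →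
      0 < θ.s2.cR * epsOfRecord θ.ν (gOfRecord₁₃ F N θ p) m ∧ θ.s2.cR * epsOfRecord θ.ν (gOfRecord₁₃ F N θ p) m ≤ a₁ ∧ B₃ * (θ.s2.cR * epsOfRecord θ.ν (gOfRecord₁₃ F N θ p) m) ≤ θ.ν.εreg)
    (ha₀ : θ.ν.εreg ≤ a₀)
    (hcomp : ∀ (p : B12.RunParams) (n : ℕ), n ≤ p.K → Step.InInterval θ.γ n (gOfRecord₁₃ F N θ p) → ∀ m, m < n →
      θ.s2.cR * epsOfRecord θ.ν (gOfRecord₁₃ F N θ p) m ≤ 2 * (θ.s2.cR * epsOfRecord θ.ν (gOfRecord₁₃ F N θ p) (m + 1)))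
    (hcomp' : ∀ (p : B12.RunParams) (n : ℕ), n ≤ p.K → Step.InInterval θ.γ n (gOfRecord₁₃ F N θ p) → ∀ m, m < n →
      θ.s2.cR * epsOfRecord θ.ν (gOfRecord₁₃ F N θ p) (m + 1) ≤ 2 * (θ.s2.cR * epsOfRecord θ.ν (gOfRecord₁₃ F N θ p) m))
    (hBα : ∀ (p : B12.RunParams) (n : ℕ), n ≤ p.K → Step.InInterval θ.γ n (gOfRecord₁₃ F N θ p) → ∀ m, 1 ≤ m → m ≤ n →
      B₃ * (θ.s2.cR * epsOfRecord θ.ν (gOfRecord₁₃ F N θ p) m) ≤ (1 - θ.s2.βc) * (lfOfRecord₁₂ F N θ.toStage12Params).alpha0 (gOfRecord₁₃ F N θ p m))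
    (htI : ∀ (p : B12.RunParams) (n : ℕ), n ≤ p.K → Step.InInterval θ.γ n (gOfRecord₁₃ F N θ p) → ∀ m, 1 ≤ m → m ≤ n →
      B₃' * (θ.s2.cR * epsOfRecord θ.ν (gOfRecord₁₃ F N θ p) m) ≤ θ.s2.cB * (lfOfRecord₁₂ F N θ.toStage12Params).alpha0 (gOfRecord₁₃ F N θ p m))
    (htMS : ∀ (p : B12.RunParams) (n : ℕ), n ≤ p.K → Step.InInterval θ.γ n (gOfRecord₁₃ F N θ p) → ∀ m, 1 ≤ m → m ≤ n →
      B₃' * (θ.s2.cR * epsOfRecord θ.ν (gOfRecord₁₃ F N θ p) m) ≤ θ.s2.B * θ.s2.C * θ.s2.Mr * (lfOfRecord₁₂ F N θ.toStage12Params).alpha0 (gOfRecord₁₃ F N θ p m))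
    (hC1 : ∀ (p : B12.RunParams) (n : ℕ), n ≤ p.K → Step.InInterval θ.γ n (gOfRecord₁₃ F N θ p) → ∀ j, 1 ≤ j → j ≤ n →
      ∃ t : ℕ, 0 < t ∧ RkOfRecord (F.P p.K).L θ.ν.r (gOfRecord₁₃ F N θ p j) = (F.P p.K).L * t)
    (hsN : ∀ (p : B12.RunParams) (n : ℕ), n ≤ p.K → ∀ n', 1 ≤ n' → n' ≤ n + 1 →
      ((B14.Eq213MaximalDomains.side (F.P p.K).L θ.τ9.M n' : ℕ) : ℤ) < (F.P p.K).sitesPerDir 0) :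
    ∀ (p : B12.RunParams) (n : ℕ), n ≤ p.K → Step.InInterval θ.γ n (gOfRecord₁₃ F N θ p) → PartCompat₁₃ F N θ p n →
      ∀ s : SeqOfRecord F θ.ν θ.τ9.M (gOfRecord₁₃ F N θ p) p.K n, Sect2.SeqSeparated θ.ν.M₁ s → 0 < θ.ν.M₁ →
      Adm θ.ν θ.τ9.M (gOfRecord₁₃ F N θ p) p.K n s → ∀ W : MSField (F.P p.K) (SU N),
      Sect2.DataSmall7PTop (avOfRecord F N p.K) s.Ω (suppDomOfRecord F θ.ν p.K s.Ω) n (fun j => θ.s2.cR * epsOfRecord θ.ν (gOfRecord₁₃ F N θ p) j) W →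
      ∀ j, 1 ≤ j → j ≤ n → ∀ X : (Sect2.domSys (F.P p.K) θ.τ9.M j).Dom,
      (Sect2.domSites (F.P p.K) θ.τ9.M j X ⊆ s.Λ j →
        Sect2.ofBackgroundC (settingOfRecord₁₃ F N θ p).ι (UbgMSCoPOfRecordB F N θ.ν θ.τ9.M (gOfRecord₁₃ F N θ p) p.K n s W) ∈
          Sect2.spaceI (settingOfRecord₁₃ F N θ p) (θ.Rz p.K) θ.τ9.M j (Sect2.domSites (F.P p.K) θ.τ9.M j X)
            ((settingOfRecord₁₃ F N θ p).lf.alpha0 ((settingOfRecord₁₃ F N θ p).flow.g j)) ((settingOfRecord₁₃ F N θ p).lf.alpha1 ((settingOfRecord₁₃ F N θ p).flow.g j))) ∧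
      (Sect2.admB (F.P p.K) θ.ν θ.τ9.M (gOfRecord₁₃ F N θ p) s.Ω s.Λ j (Sect2.domSites (F.P p.K) θ.τ9.M j X) = true →
        Sect2.ofBackgroundC (settingOfRecord₁₃ F N θ p).ι (UbgMSCoPOfRecordB F N θ.ν θ.τ9.M (gOfRecord₁₃ F N θ p) p.K n s W) ∈
          Sect2.spaceMS (settingOfRecord₁₃ F N θ p) (θ.Rz p.K) θ.τ9.M j (Sect2.domSites (F.P p.K) θ.τ9.M j X) s.Ω) :=
  Stage13Params.bgAtDatumBg_of_thm1RegSepCoP7MGB_of_thm1GaugeGB θ hθ hRz hM h15 h15G (fun p n s W => UbgMSCoPOfRecordB F N θ.ν θ.τ9.M (gOfRecord₁₃ F N θ p) p.K n s W)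
    (fun p n s W => ubgMSCoPOfRecordB_dichotomy θ.ν θ.τ9.M (gOfRecord₁₃ F N θ p) p.K n s W) hnum ha₀ hcomp hcomp' hBα htI htMS hC1 hsN

end LiftGauge

/-! ## §3. ★★★ At `θ₁₅ᶜᶜ¹`: the (7)-guarded separated row P11 at the Co carrier from the two guarded ᴮ sentences, their guard at the family and the two history clauses — every letter discharged -/

section AtWitnessGauge

variable {F : T4Family} {N : ℕ} [NeZero N] {ε₀ ε₂₉ B₃ B₃' a₀ a₁ : ℝ}

/-- **★★★ THE (7)-GUARDED SEPARATED ROW P11 AT THE Co CARRIER AT `θ₁₅ᶜᶜ¹`, PER PARTITION-COMPATIBLE RUN, FROM THE TWO GUARDED [15] SENTENCES OVER PRINT's DATUM — (8)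
`VariationalThm1RegSepCoP7MGB F N Adm (lamDatum F) (dataSmall7PTopOf F N) B₃ a₀ a₁` AND (9)-LINE-1 `VariationalThm1GaugeRegSepCoP7MGB F N 1 Adm (lamDatum F) (dataSmall7PTopOf F N) B₃ B₃' a₀ a₁` (cube letter
`M = 1` of the record) — THEIR GUARD AT THE WITNESS FAMILY (`hAdm`) AND THE TWO HISTORY CLAUSES** (hmono ⇒ `ε_m ≤ 2ε_{m+1}` by 13b; hcompRev by 14d): at level `n+1` the carrier IS node00-def-R's
print-datum background `UbgMSCoPOfRecordB …` (`UbgOfRecord₁₃CoP_succ` after the Stage-2 seam) and §2 applies with 13b–e's letters `hnum_`∕`εreg_le_`∕`hBα_`∕`hsN_`∕`hC1_theta13OfThm1CC1` and §1's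
`htI_`∕`htMS_theta13OfThm1CC1`, `M₁ = 1 > 0`, the guard by `hAdm`; level `0` is vacuous.  16a's hypothesis `hbgSepCoP` VERBATIM.  CONDITIONAL; nothing of Bałaban asserted. [cite: Balaban1985Variational, (6)–(7) p.278, Thm 1 (8)–(9) p.279, (152) p.301, Prop. 8 p.304, p.304 lines 1–2; Balaban1985RegularSpaces, (1.3)–(1.9) p.77; Balaban1984PropagatorsII, (2.3) p.224; Balaban1988Convergent, Thm 1 p.262, (2.4)–(2.8) pp.255–256, (2.12)–(2.13) p.256, (2.27)–(2.28) p.259, (2.34)–(2.41) p.261, (3.16)–(3.22) pp.268–269; Balaban1987RG1, (0.1) p.251, (1.11)–(1.12) p.262; Balaban1989LargeFieldI, (0.3)–(0.4) p.176] -/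
theorem bgSepCoPAt_theta13OfThm1CC1_of_thm1Gauge (hε : 0 < ε₀) (hε' : 0 < ε₂₉) (hB : 0 ≤ B₃) (hB' : 0 ≤ B₃') (ha₀ : 0 < a₀) (ha₁ : 0 < a₁) {Adm : StepGuard F}
    (h15 : VariationalThm1RegSepCoP7MGB F N Adm (lamDatum F) (dataSmall7PTopOf F N) B₃ a₀ a₁) (h15G : VariationalThm1GaugeRegSepCoP7MGB F N 1 Adm (lamDatum F) (dataSmall7PTopOf F N) B₃ B₃' a₀ a₁)
    (hAdm : ∀ (p : B12.RunParams) (n : ℕ) (s : SeqOfRecord F (theta13OfThm1CC1 F N ε₀ ε₂₉ B₃ B₃' a₀ a₁).ν (theta13OfThm1CC1 F N ε₀ ε₂₉ B₃ B₃' a₀ a₁).τ9.M (gOfRecord₁₃ F N (theta13OfThm1CC1 F N ε₀ ε₂₉ B₃ B₃' a₀ a₁) p) p.K n), 1 ≤ n → n ≤ p.K →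
      Step.InInterval (theta13OfThm1CC1 F N ε₀ ε₂₉ B₃ B₃' a₀ a₁).γ n (gOfRecord₁₃ F N (theta13OfThm1CC1 F N ε₀ ε₂₉ B₃ B₃' a₀ a₁) p) → PartCompat₁₃ F N (theta13OfThm1CC1 F N ε₀ ε₂₉ B₃ B₃' a₀ a₁) p n → Adm (theta13OfThm1CC1 F N ε₀ ε₂₉ B₃ B₃' a₀ a₁).ν (theta13OfThm1CC1 F N ε₀ ε₂₉ B₃ B₃' a₀ a₁).τ9.M (gOfRecord₁₃ F N (theta13OfThm1CC1 F N ε₀ ε₂₉ B₃ B₃' a₀ a₁) p) p.K n s)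
    (hmono : ∀ (p : B12.RunParams) (n : ℕ), n ≤ p.K → Step.InInterval (theta13OfThm1CC1 F N ε₀ ε₂₉ B₃ B₃' a₀ a₁).γ n (gOfRecord₁₃ F N (theta13OfThm1CC1 F N ε₀ ε₂₉ B₃ B₃' a₀ a₁) p) → ∀ m, m < n →
      gOfRecord₁₃ F N (theta13OfThm1CC1 F N ε₀ ε₂₉ B₃ B₃' a₀ a₁) p m ≤ gOfRecord₁₃ F N (theta13OfThm1CC1 F N ε₀ ε₂₉ B₃ B₃' a₀ a₁) p (m + 1))
    (hcompRev : ∀ (p : B12.RunParams) (n : ℕ), n ≤ p.K → Step.InInterval (theta13OfThm1CC1 F N ε₀ ε₂₉ B₃ B₃' a₀ a₁).γ n (gOfRecord₁₃ F N (theta13OfThm1CC1 F N ε₀ ε₂₉ B₃ B₃' a₀ a₁) p) → ∀ m, m < n →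
      (theta13OfThm1CC1 F N ε₀ ε₂₉ B₃ B₃' a₀ a₁).s2.cR * epsOfRecord (theta13OfThm1CC1 F N ε₀ ε₂₉ B₃ B₃' a₀ a₁).ν (gOfRecord₁₃ F N (theta13OfThm1CC1 F N ε₀ ε₂₉ B₃ B₃' a₀ a₁) p) (m + 1) ≤ 2 * ((theta13OfThm1CC1 F N ε₀ ε₂₉ B₃ B₃' a₀ a₁).s2.cR * epsOfRecord (theta13OfThm1CC1 F N ε₀ ε₂₉ B₃ B₃' a₀ a₁).ν (gOfRecord₁₃ F N (theta13OfThm1CC1 F N ε₀ ε₂₉ B₃ B₃' a₀ a₁) p) m)) :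
    ∀ (p : B12.RunParams) (n : ℕ), n ≤ p.K → Step.InInterval (theta13OfThm1CC1 F N ε₀ ε₂₉ B₃ B₃' a₀ a₁).γ n (gOfRecord₁₃ F N (theta13OfThm1CC1 F N ε₀ ε₂₉ B₃ B₃' a₀ a₁) p) → PartCompat₁₃ F N (theta13OfThm1CC1 F N ε₀ ε₂₉ B₃ B₃' a₀ a₁) p n →
      ∀ s : SeqOfRecord F (theta13OfThm1CC1 F N ε₀ ε₂₉ B₃ B₃' a₀ a₁).ν (theta13OfThm1CC1 F N ε₀ ε₂₉ B₃ B₃' a₀ a₁).τ9.M (gOfRecord₁₃ F N (theta13OfThm1CC1 F N ε₀ ε₂₉ B₃ B₃' a₀ a₁) p) p.K n, Sect2.SeqSeparated (theta13OfThm1CC1 F N ε₀ ε₂₉ B₃ B₃' a₀ a₁).ν.M₁ s →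
      ∀ W : MSField (F.P p.K) (SU N), W ∈ suppOfRecord₁₃P F N (theta13OfThm1CC1 F N ε₀ ε₂₉ B₃ B₃' a₀ a₁) p n s →
      Sect2.DataSmall7PTop (avOfRecord F N p.K) s.Ω (suppDomOfRecord F (theta13OfThm1CC1 F N ε₀ ε₂₉ B₃ B₃' a₀ a₁).ν p.K s.Ω) n (fun j => (theta13OfThm1CC1 F N ε₀ ε₂₉ B₃ B₃' a₀ a₁).s2.cR * epsOfRecord (theta13OfThm1CC1 F N ε₀ ε₂₉ B₃ B₃' a₀ a₁).ν (gOfRecord₁₃ F N (theta13OfThm1CC1 F N ε₀ ε₂₉ B₃ B₃' a₀ a₁) p) j) W →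
      ∀ j, 1 ≤ j → j ≤ n → ∀ X : (Sect2.domSys (F.P p.K) (theta13OfThm1CC1 F N ε₀ ε₂₉ B₃ B₃' a₀ a₁).τ9.M j).Dom,
      (Sect2.domSites (F.P p.K) (theta13OfThm1CC1 F N ε₀ ε₂₉ B₃ B₃' a₀ a₁).τ9.M j X ⊆ s.Λ j →
        Sect2.ofBackgroundC (settingOfRecord₁₃ F N (theta13OfThm1CC1 F N ε₀ ε₂₉ B₃ B₃' a₀ a₁) p).ι (UbgOfRecord₁₃CoP F N (theta13OfThm1CC1 F N ε₀ ε₂₉ B₃ B₃' a₀ a₁) p n s W) ∈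
          Sect2.spaceI (settingOfRecord₁₃ F N (theta13OfThm1CC1 F N ε₀ ε₂₉ B₃ B₃' a₀ a₁) p) ((theta13OfThm1CC1 F N ε₀ ε₂₉ B₃ B₃' a₀ a₁).Rz p.K) (theta13OfThm1CC1 F N ε₀ ε₂₉ B₃ B₃' a₀ a₁).τ9.M j (Sect2.domSites (F.P p.K) (theta13OfThm1CC1 F N ε₀ ε₂₉ B₃ B₃' a₀ a₁).τ9.M j X)
            ((settingOfRecord₁₃ F N (theta13OfThm1CC1 F N ε₀ ε₂₉ B₃ B₃' a₀ a₁) p).lf.alpha0 ((settingOfRecord₁₃ F N (theta13OfThm1CC1 F N ε₀ ε₂₉ B₃ B₃' a₀ a₁) p).flow.g j)) ((settingOfRecord₁₃ F N (theta13OfThm1CC1 F N ε₀ ε₂₉ B₃ B₃' a₀ a₁) p).lf.alpha1 ((settingOfRecord₁₃ F N (theta13OfThm1CC1 F N ε₀ ε₂₉ B₃ B₃' a₀ a₁) p).flow.g j))) ∧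
      (Sect2.admB (F.P p.K) (theta13OfThm1CC1 F N ε₀ ε₂₉ B₃ B₃' a₀ a₁).ν (theta13OfThm1CC1 F N ε₀ ε₂₉ B₃ B₃' a₀ a₁).τ9.M (gOfRecord₁₃ F N (theta13OfThm1CC1 F N ε₀ ε₂₉ B₃ B₃' a₀ a₁) p) s.Ω s.Λ j (Sect2.domSites (F.P p.K) (theta13OfThm1CC1 F N ε₀ ε₂₉ B₃ B₃' a₀ a₁).τ9.M j X) = true →
        Sect2.ofBackgroundC (settingOfRecord₁₃ F N (theta13OfThm1CC1 F N ε₀ ε₂₉ B₃ B₃' a₀ a₁) p).ι (UbgOfRecord₁₃CoP F N (theta13OfThm1CC1 F N ε₀ ε₂₉ B₃ B₃' a₀ a₁) p n s W) ∈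
          Sect2.spaceMS (settingOfRecord₁₃ F N (theta13OfThm1CC1 F N ε₀ ε₂₉ B₃ B₃' a₀ a₁) p) ((theta13OfThm1CC1 F N ε₀ ε₂₉ B₃ B₃' a₀ a₁).Rz p.K) (theta13OfThm1CC1 F N ε₀ ε₂₉ B₃ B₃' a₀ a₁).τ9.M j (Sect2.domSites (F.P p.K) (theta13OfThm1CC1 F N ε₀ ε₂₉ B₃ B₃' a₀ a₁).τ9.M j X) s.Ω) := by
  intro p n hn hw hpc s hsep W _ h7
  cases n with
  | zero => intro j h1 hj; exfalso; omega
  | succ n =>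
    rw [UbgOfRecord₁₃CoP_succ]
    exact Stage13Params.bgAtDatumCoP_of_thm1RegSepCoP7M_of_thm1Gauge (theta13OfThm1CC1 F N ε₀ ε₂₉ B₃ B₃' a₀ a₁) (admissible_theta13OfThm1CC1 F N hε hε' hB hB' ha₀ ha₁) rfl
      (by rw [theta13OfThm1CC1_τ9_M]; exact Nat.one_pos) h15 h15G (hnum_theta13OfThm1CC1 hB hB' ha₀ ha₁) εreg_le_theta13OfThm1CC1
      (hcomp_theta13OfThm1CC1_of_monotone hB hB' ha₀.le ha₁.le hmono) hcompRev (hBα_theta13OfThm1CC1 hB hB' ha₀.le ha₁.le)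
      (htI_theta13OfThm1CC1 hB hB' ha₀.le ha₁.le) (htMS_theta13OfThm1CC1 hB hB' ha₀.le ha₁.le) hC1_theta13OfThm1CC1 hsN_theta13OfThm1CC1
      p (n + 1) hn hw hpc s hsep (by rw [theta13OfThm1CC1_M₁]; exact Nat.one_pos) (hAdm p (n + 1) s (Nat.succ_pos n) hn hw hpc) W h7

/-- **★★ THE v1.5 PROVISOS OF RECORD AT `θ₁₅ᶜᶜ¹`** from the signs, the two guarded ᴮ sentences, their guard at the family and the two history clauses (16a's
`provisos₁₃SepCoP_theta13LiveOfNumerics_of_bgSepCoP` ∘ ★★★; pins `M = 1 = L⁰`, `M₁ = 1 ∣ 1`). [cite: Balaban1985Variational, (6)–(7) p.278, Thm 1 (8)–(9) p.279, (152) p.301, Prop. 8 p.304, p.304 lines 1–2; Balaban1985RegularSpaces, (1.3)–(1.9) p.77; Balaban1984PropagatorsII, (2.3) p.224; Balaban1988Convergent, Thm 1 p.262, (2.4)–(2.8) pp.255–256, (2.12)–(2.13) p.256, (2.27)–(2.28) p.259, (2.34)–(2.41) p.261, (3.16)–(3.22) pp.268–269; Balaban1987RG1, (0.1) p.251, (1.11)–(1.12)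 p.262; Balaban1989LargeFieldI, (0.3)–(0.4) p.176] -/
theorem provisos₁₃SepCoP_theta13OfThm1CC1_of_thm1Gauge (hε : 0 < ε₀) (hε' : 0 < ε₂₉) (hB : 0 ≤ B₃) (hB' : 0 ≤ B₃') (ha₀ : 0 < a₀) (ha₁ : 0 < a₁) {Adm : StepGuard F}
    (h15 : VariationalThm1RegSepCoP7MGB F N Adm (lamDatum F) (dataSmall7PTopOf F N) B₃ a₀ a₁) (h15G : VariationalThm1GaugeRegSepCoP7MGB F N 1 Adm (lamDatum F) (dataSmall7PTopOf F N) B₃ B₃' a₀ a₁)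
    (hAdm : ∀ (p : B12.RunParams) (n : ℕ) (s : SeqOfRecord F (theta13OfThm1CC1 F N ε₀ ε₂₉ B₃ B₃' a₀ a₁).ν (theta13OfThm1CC1 F N ε₀ ε₂₉ B₃ B₃' a₀ a₁).τ9.M (gOfRecord₁₃ F N (theta13OfThm1CC1 F N ε₀ ε₂₉ B₃ B₃' a₀ a₁) p) p.K n), 1 ≤ n → n ≤ p.K →
      Step.InInterval (theta13OfThm1CC1 F N ε₀ ε₂₉ B₃ B₃' a₀ a₁).γ n (gOfRecord₁₃ F N (theta13OfThm1CC1 F N ε₀ ε₂₉ B₃ B₃' a₀ a₁) p) → PartCompat₁₃ F N (theta13OfThm1CC1 F N ε₀ ε₂₉ B₃ B₃' a₀ a₁) p n → Adm (theta13OfThm1CC1 F N ε₀ ε₂₉ B₃ B₃' a₀ a₁).ν (theta13OfThm1CC1 F N ε₀ ε₂₉ B₃ B₃' a₀ a₁).τ9.M (gOfRecord₁₃ F N (theta13OfThm1CC1 F N ε₀ ε₂₉ B₃ B₃' a₀ a₁) p) p.K n s)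
    (hmono : ∀ (p : B12.RunParams) (n : ℕ), n ≤ p.K → Step.InInterval (theta13OfThm1CC1 F N ε₀ ε₂₉ B₃ B₃' a₀ a₁).γ n (gOfRecord₁₃ F N (theta13OfThm1CC1 F N ε₀ ε₂₉ B₃ B₃' a₀ a₁) p) → ∀ m, m < n →
      gOfRecord₁₃ F N (theta13OfThm1CC1 F N ε₀ ε₂₉ B₃ B₃' a₀ a₁) p m ≤ gOfRecord₁₃ F N (theta13OfThm1CC1 F N ε₀ ε₂₉ B₃ B₃' a₀ a₁) p (m + 1))
    (hcompRev : ∀ (p : B12.RunParams) (n : ℕ), n ≤ p.K → Step.InInterval (theta13OfThm1CC1 F N ε₀ ε₂₉ B₃ B₃' a₀ a₁).γ n (gOfRecord₁₃ F N (theta13OfThm1CC1 F N ε₀ ε₂₉ B₃ B₃' a₀ a₁) p) → ∀ m, m < n →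
      (theta13OfThm1CC1 F N ε₀ ε₂₉ B₃ B₃' a₀ a₁).s2.cR * epsOfRecord (theta13OfThm1CC1 F N ε₀ ε₂₉ B₃ B₃' a₀ a₁).ν (gOfRecord₁₃ F N (theta13OfThm1CC1 F N ε₀ ε₂₉ B₃ B₃' a₀ a₁) p) (m + 1) ≤ 2 * ((theta13OfThm1CC1 F N ε₀ ε₂₉ B₃ B₃' a₀ a₁).s2.cR * epsOfRecord (theta13OfThm1CC1 F N ε₀ ε₂₉ B₃ B₃' a₀ a₁).ν (gOfRecord₁₃ F N (theta13OfThm1CC1 F N ε₀ ε₂₉ B₃ B₃' a₀ a₁) p) m)) :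
    (theta13OfThm1CC1 F N ε₀ ε₂₉ B₃ B₃' a₀ a₁).Provisos₁₃SepCoP F N :=
  provisos₁₃SepCoP_theta13LiveOfNumerics_of_bgSepCoP F N (stage12NumericsOfThm1CC1 F.L ε₀ B₃ B₃' a₀ a₁) ε₂₉ ⟨0, rfl⟩ (dvd_refl _)
    (bgSepCoPAt_theta13OfThm1CC1_of_thm1Gauge hε hε' hB hB' ha₀ ha₁ h15 h15G hAdm hmono hcompRev)

end AtWitnessGauge

/-! ## §4. Closers: the ⁵ and ⁶ K0 bodies for `F` at `N = 2` from the two guarded ᴮ sentences ∕ the ᴮ step fact, their guard at the family, and the β-box -/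

section ClosersGauge

variable {ε₀ ε₂₉ B₃ B₃' a₀ a₁ : ℝ}

/-- **★★★★★ THE v1.5 K0 BODY FOR `F` AT `N = 2` FROM THE TWO GUARDED `CoP` [15]-FACT INSTANCES OVER PRINT's DATUM — (8) `VariationalThm1RegSepCoP7MGB F 2 Adm (lamDatum F) (dataSmall7PTopOf F 2) B₃ a₀ a₁`
AND (9)-LINE-1 `VariationalThm1GaugeRegSepCoP7MGB F 2 1 Adm (lamDatum F) (dataSmall7PTopOf F 2) B₃ B₃' a₀ a₁` — THEIR GUARD AT THE WITNESS FAMILY AND THE TWO HISTORY CLAUSES**: 16a's socket ∘ §3.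
NO class clause, NO C¹ sentence, NO axial letter displayed.  CONDITIONAL — nothing of Bałaban asserted; K0 NOT closed here. [cite: Balaban1985Variational, (6)–(7) p.278, Thm 1 (8)–(9) p.279, (152) p.301, Prop. 8 p.304, p.304 lines 1–2; Balaban1985RegularSpaces, (1.3)–(1.9) p.77; Balaban1984PropagatorsII, (2.3) p.224; Balaban1988Convergent, Thm 1 p.262, (2.4)–(2.8) pp.255–256, (2.12)–(2.13) p.256, (2.27)–(2.28) p.259, (2.34)–(2.41) p.261, (3.16)–(3.22) pp.268–269; Balaban1987RG1, (0.1) p.251, (1.11)–(1.12) p.262; Balaban1989LargeFieldI, (0.3)–(0.4) p.176] -/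
theorem exists_k0SepCoP_of_thm1RegSepCoP7M_of_thm1Gauge (F : T4Family) (hε : 0 < ε₀) (hε' : 0 < ε₂₉) (hB : 0 ≤ B₃) (hB' : 0 ≤ B₃') (ha₀ : 0 < a₀) (ha₁ : 0 < a₁) {Adm : StepGuard F}
    (h15 : VariationalThm1RegSepCoP7MGB F 2 Adm (lamDatum F) (dataSmall7PTopOf F 2) B₃ a₀ a₁) (h15G : VariationalThm1GaugeRegSepCoP7MGB F 2 1 Adm (lamDatum F) (dataSmall7PTopOf F 2) B₃ B₃' a₀ a₁)
    (hAdm : ∀ (p : B12.RunParams) (n : ℕ) (s : SeqOfRecord F (theta13OfThm1CC1 F 2 ε₀ ε₂₉ B₃ B₃' a₀ a₁).ν (theta13OfThm1CC1 F 2 ε₀ ε₂₉ B₃ B₃' a₀ a₁).τ9.M (gOfRecord₁₃ F 2 (theta13OfThm1CC1 F 2 ε₀ ε₂₉ B₃ B₃' a₀ a₁) p) p.K n), 1 ≤ n → n ≤ p.K →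
      Step.InInterval (theta13OfThm1CC1 F 2 ε₀ ε₂₉ B₃ B₃' a₀ a₁).γ n (gOfRecord₁₃ F 2 (theta13OfThm1CC1 F 2 ε₀ ε₂₉ B₃ B₃' a₀ a₁) p) → PartCompat₁₃ F 2 (theta13OfThm1CC1 F 2 ε₀ ε₂₉ B₃ B₃' a₀ a₁) p n → Adm (theta13OfThm1CC1 F 2 ε₀ ε₂₉ B₃ B₃' a₀ a₁).ν (theta13OfThm1CC1 F 2 ε₀ ε₂₉ B₃ B₃' a₀ a₁).τ9.M (gOfRecord₁₃ F 2 (theta13OfThm1CC1 F 2 ε₀ ε₂₉ B₃ B₃' a₀ a₁) p) p.K n s)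
    (hmono : ∀ (p : B12.RunParams) (n : ℕ), n ≤ p.K → Step.InInterval (theta13OfThm1CC1 F 2 ε₀ ε₂₉ B₃ B₃' a₀ a₁).γ n (gOfRecord₁₃ F 2 (theta13OfThm1CC1 F 2 ε₀ ε₂₉ B₃ B₃' a₀ a₁) p) → ∀ m, m < n →
      gOfRecord₁₃ F 2 (theta13OfThm1CC1 F 2 ε₀ ε₂₉ B₃ B₃' a₀ a₁) p m ≤ gOfRecord₁₃ F 2 (theta13OfThm1CC1 F 2 ε₀ ε₂₉ B₃ B₃' a₀ a₁) p (m + 1))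
    (hcompRev : ∀ (p : B12.RunParams) (n : ℕ), n ≤ p.K → Step.InInterval (theta13OfThm1CC1 F 2 ε₀ ε₂₉ B₃ B₃' a₀ a₁).γ n (gOfRecord₁₃ F 2 (theta13OfThm1CC1 F 2 ε₀ ε₂₉ B₃ B₃' a₀ a₁) p) → ∀ m, m < n →
      (theta13OfThm1CC1 F 2 ε₀ ε₂₉ B₃ B₃' a₀ a₁).s2.cR * epsOfRecord (theta13OfThm1CC1 F 2 ε₀ ε₂₉ B₃ B₃' a₀ a₁).ν (gOfRecord₁₃ F 2 (theta13OfThm1CC1 F 2 ε₀ ε₂₉ B₃ B₃' a₀ a₁) p) (m + 1) ≤ 2 * ((theta13OfThm1CC1 F 2 ε₀ ε₂₉ B₃ B₃' a₀ a₁).s2.cR * epsOfRecord (theta13OfThm1CC1 F 2 ε₀ ε₂₉ B₃ B₃' a₀ a₁).ν (gOfRecord₁₃ F 2 (theta13OfThm1CC1 F 2 ε₀ ε₂₉ B₃ B₃' a₀ a₁) p) m)) :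
    ∃ θ : Stage13Params F 2, θ.Provisos₁₃SepCoP F 2 ∧ (θ.ZtUnity F 2 ∧ θ.SlotsNondegenerate₁₃ F 2) ∧ θ.Admissible F 2 :=
  exists_k0SepCoP_of_bgSepCoP_theta13LiveOfNumerics F (stage12NumericsOfThm1CC1_pos (L := F.L) hε hB hB' ha₀ ha₁) hε' ⟨0, rfl⟩ (dvd_refl _)
    (bgSepCoPAt_theta13OfThm1CC1_of_thm1Gauge hε hε' hB hB' ha₀ ha₁ h15 h15G hAdm hmono hcompRev)

/-- **★★★★★★ THE v1.5 K0 BODY FOR `F` FROM THE TWO GUARDED SENTENCES OVER PRINT's DATUM, THEIR GUARD AT THE FAMILY AND THE β-BOX LEAF** (history clauses by 13e `hmono_theta13OfThm1CC1_of_betaLowerH`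
and 14d `hcompRev_theta13OfThm1CC1_of_betaBox`): Cut B‴ = (i) `VariationalThm1RegSepCoP7MGB F 2 Adm (lamDatum F) (dataSmall7PTopOf F 2) B₃ a₀ a₁`, (ii) `VariationalThm1GaugeRegSepCoP7MGB F 2 1 Adm
(lamDatum F) (dataSmall7PTopOf F 2) B₃ B₃' a₀ a₁`, (iii) `hAdm`, (iv) the β-box of `betaOfRecord₁₃ F 2 θ₁₅ᶜᶜ¹`, (v) signs.  CONDITIONAL. [cite: Balaban1985Variational, (6)–(7) p.278, Thm 1 (8)–(9) p.279, (152) p.301, Prop. 8 p.304, p.304 lines 1–2; Balaban1985RegularSpaces, (1.3)–(1.9) p.77; Balaban1984PropagatorsII, (2.3) p.224; Balaban1988Convergent, Thm 1 p.262, (2.4)–(2.8) pp.255–256, (2.12)–(2.13) p.256, (2.27)–(2.28) p.259, (2.34)–(2.41) p.261, (3.16)–(3.22) pp.268–269; Balaban1987RG1, (0.1) p.251, (1.11)–(1.12) p.262; Balaban1989LargeFieldI, (0.3)–(0.4) p.176] -/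
theorem exists_k0SepCoP_of_thm1RegSepCoP7M_of_thm1Gauge_of_betaBox (F : T4Family) (hε : 0 < ε₀) (hε' : 0 < ε₂₉) (hB : 0 ≤ B₃) (hB' : 0 ≤ B₃') (ha₀ : 0 < a₀) (ha₁ : 0 < a₁) {Adm : StepGuard F}
    (h15 : VariationalThm1RegSepCoP7MGB F 2 Adm (lamDatum F) (dataSmall7PTopOf F 2) B₃ a₀ a₁) (h15G : VariationalThm1GaugeRegSepCoP7MGB F 2 1 Adm (lamDatum F) (dataSmall7PTopOf F 2) B₃ B₃' a₀ a₁)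
    (hAdm : ∀ (p : B12.RunParams) (n : ℕ) (s : SeqOfRecord F (theta13OfThm1CC1 F 2 ε₀ ε₂₉ B₃ B₃' a₀ a₁).ν (theta13OfThm1CC1 F 2 ε₀ ε₂₉ B₃ B₃' a₀ a₁).τ9.M (gOfRecord₁₃ F 2 (theta13OfThm1CC1 F 2 ε₀ ε₂₉ B₃ B₃' a₀ a₁) p) p.K n), 1 ≤ n → n ≤ p.K →
      Step.InInterval (theta13OfThm1CC1 F 2 ε₀ ε₂₉ B₃ B₃' a₀ a₁).γ n (gOfRecord₁₃ F 2 (theta13OfThm1CC1 F 2 ε₀ ε₂₉ B₃ B₃' a₀ a₁) p) → PartCompat₁₃ F 2 (theta13OfThm1CC1 F 2 ε₀ ε₂₉ B₃ B₃' a₀ a₁) p n → Adm (theta13OfThm1CC1 F 2 ε₀ ε₂₉ B₃ B₃' a₀ a₁).ν (theta13OfThm1CC1 F 2 ε₀ ε₂₉ B₃ B₃' a₀ a₁).τ9.M (gOfRecord₁₃ F 2 (theta13OfThm1CC1 F 2 ε₀ ε₂₉ B₃ B₃' a₀ a₁) p) p.K n s)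
    {b β' : ℝ} (hb : 0 ≤ b) (hlow : FlowStep.BetaLowerH b (1 / 2) (betaOfRecord₁₃ F 2 (theta13OfThm1CC1 F 2 ε₀ ε₂₉ B₃ B₃' a₀ a₁)))
    (hup : FlowStep.BetaUpperH β' (1 / 2) (betaOfRecord₁₃ F 2 (theta13OfThm1CC1 F 2 ε₀ ε₂₉ B₃ B₃' a₀ a₁))) (hβ' : β' ≤ 3) :
    ∃ θ : Stage13Params F 2, θ.Provisos₁₃SepCoP F 2 ∧ (θ.ZtUnity F 2 ∧ θ.SlotsNondegenerate₁₃ F 2) ∧ θ.Admissible F 2 :=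
  exists_k0SepCoP_of_thm1RegSepCoP7M_of_thm1Gauge F hε hε' hB hB' ha₀ ha₁ h15 h15G hAdm (hmono_theta13OfThm1CC1_of_betaLowerH hb hlow)
    (hcompRev_theta13OfThm1CC1_of_betaBox hB hB' ha₀.le ha₁.le hb hlow hup hβ')

/-- **★★★★★★★ CUT B‴ KEYED ON THE ᴮ STEP FACT**: the v1.5 K0 body for `F` from (8) `VariationalThm1RegSepCoP7MGB F 2 Adm (lamDatum F) (dataSmall7PTopOf F 2) B₃ a₀ a₁`, [15] Sect. F's (9)-STEP OVER PRINT's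
DATUM `Gauge9RegSepTopStepGB F 2 Sup 1 Adm (lamDatum F) (dataSmall7PTopOf F 2) B₃ B₃' a₀ a₁` at node00-def-R's support selector and the record's cube letter `M = 1` (dag-n07-w2 S1b-2 §3
`variationalThm1GaugeRegSepCoP7MGB_of_gauge9TopStepGB`: minimal ⇒ critical on the `lamBondsSeq`-fibre), the guard at the family, the β-box leaf and the signs.  CONDITIONAL — both facts are hypotheses. [cite: Balaban1985Variational, (6)–(7) p.278, Thm 1 (8)–(9) p.279, (152) p.301, Prop. 8 p.304, p.304 lines 1–2; Balaban1985RegularSpaces, (1.3)–(1.9) p.77; Balaban1984PropagatorsII, (2.3) p.224; Balaban1988Convergent, Thm 1 p.262, (2.4)–(2.8) pp.255–256, (2.12)–(2.13) p.256, (2.27)–(2.28) p.259, (2.34)–(2.41) p.261, (3.16)–(3.22) pp.268–269; Balaban1987RG1, (0.1) p.251, (1.11)–(1.12) p.262; Balaban1989LargeFieldI, (0.3)–(0.4) p.176] -/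
theorem exists_k0SepCoP_of_thm1RegSepCoP7M_of_gauge9TopStep_of_betaBox (F : T4Family) (hε : 0 < ε₀) (hε' : 0 < ε₂₉) (hB : 0 ≤ B₃) (hB' : 0 ≤ B₃') (ha₀ : 0 < a₀) (ha₁ : 0 < a₁) {Adm : StepGuard F}
    (h15 : VariationalThm1RegSepCoP7MGB F 2 Adm (lamDatum F) (dataSmall7PTopOf F 2) B₃ a₀ a₁) (h9 : Gauge9RegSepTopStepGB F 2 (fun ν K Ω => suppDomOfRecord F ν K Ω) 1 Adm (lamDatum F) (dataSmall7PTopOf F 2) B₃ B₃' a₀ a₁)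
    (hAdm : ∀ (p : B12.RunParams) (n : ℕ) (s : SeqOfRecord F (theta13OfThm1CC1 F 2 ε₀ ε₂₉ B₃ B₃' a₀ a₁).ν (theta13OfThm1CC1 F 2 ε₀ ε₂₉ B₃ B₃' a₀ a₁).τ9.M (gOfRecord₁₃ F 2 (theta13OfThm1CC1 F 2 ε₀ ε₂₉ B₃ B₃' a₀ a₁) p) p.K n), 1 ≤ n → n ≤ p.K →
      Step.InInterval (theta13OfThm1CC1 F 2 ε₀ ε₂₉ B₃ B₃' a₀ a₁).γ n (gOfRecord₁₃ F 2 (theta13OfThm1CC1 F 2 ε₀ ε₂₉ B₃ B₃' a₀ a₁) p) → PartCompat₁₃ F 2 (theta13OfThm1CC1 F 2 ε₀ ε₂₉ B₃ B₃' a₀ a₁) p n → Adm (theta13OfThm1CC1 F 2 ε₀ ε₂₉ B₃ B₃' a₀ a₁).ν (theta13OfThm1CC1 F 2 ε₀ ε₂₉ B₃ B₃' a₀ a₁).τ9.M (gOfRecord₁₃ F 2 (theta13OfThm1CC1 F 2 ε₀ ε₂₉ B₃ B₃' a₀ a₁) p) p.K n s)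
    {b β' : ℝ} (hb : 0 ≤ b) (hlow : FlowStep.BetaLowerH b (1 / 2) (betaOfRecord₁₃ F 2 (theta13OfThm1CC1 F 2 ε₀ ε₂₉ B₃ B₃' a₀ a₁)))
    (hup : FlowStep.BetaUpperH β' (1 / 2) (betaOfRecord₁₃ F 2 (theta13OfThm1CC1 F 2 ε₀ ε₂₉ B₃ B₃' a₀ a₁))) (hβ' : β' ≤ 3) :
    ∃ θ : Stage13Params F 2, θ.Provisos₁₃SepCoP F 2 ∧ (θ.ZtUnity F 2 ∧ θ.SlotsNondegenerate₁₃ F 2) ∧ θ.Admissible F 2 :=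
  exists_k0SepCoP_of_thm1RegSepCoP7M_of_thm1Gauge_of_betaBox F hε hε' hB hB' ha₀ ha₁ h15 (variationalThm1GaugeRegSepCoP7MGB_of_gauge9TopStepGB h9) hAdm hb hlow hup hβ'

/-- **THE ⁶ IMAGE OF ★★★★★** (the hoisted trunk's `exists_k0SepCoPR_of_exists_k0SepCoP`: cured witness `⟨θ₁₅ᶜᶜ¹, ZrOfRecord₁₃ F 2 θ₁₅ᶜᶜ¹⟩`). [cite: Balaban1985Variational, (6)–(7) p.278, Thm 1 (8)–(9) p.279, (152) p.301, Prop. 8 p.304, p.304 lines 1–2; Balaban1985RegularSpaces, (1.3)–(1.9) p.77; Balaban1984PropagatorsII, (2.3) p.224; Balaban1988Convergent, Thm 1 p.262, (2.4)–(2.8) pp.255–256, (2.12)–(2.13) p.256, (2.27)–(2.28) p.259, (2.34)–(2.41) p.261, (3.16)–(3.22) pp.268–269; Balaban1987RG1, (0.1) p.251, (1.11)–(1.12) p.262; Balaban1989LargeFieldI, (0.3)–(0.4) p.176] -/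
theorem exists_k0SepCoPR_of_thm1RegSepCoP7M_of_thm1Gauge (F : T4Family) (hε : 0 < ε₀) (hε' : 0 < ε₂₉) (hB : 0 ≤ B₃) (hB' : 0 ≤ B₃') (ha₀ : 0 < a₀) (ha₁ : 0 < a₁) {Adm : StepGuard F}
    (h15 : VariationalThm1RegSepCoP7MGB F 2 Adm (lamDatum F) (dataSmall7PTopOf F 2) B₃ a₀ a₁) (h15G : VariationalThm1GaugeRegSepCoP7MGB F 2 1 Adm (lamDatum F) (dataSmall7PTopOf F 2) B₃ B₃' a₀ a₁)
    (hAdm : ∀ (p : B12.RunParams) (n : ℕ) (s : SeqOfRecord F (theta13OfThm1CC1 F 2 ε₀ ε₂₉ B₃ B₃' a₀ a₁).ν (theta13OfThm1CC1 F 2 ε₀ ε₂₉ B₃ B₃' a₀ a₁).τ9.M (gOfRecord₁₃ F 2 (theta13OfThm1CC1 F 2 ε₀ ε₂₉ B₃ B₃' a₀ a₁) p) p.K n), 1 ≤ n → n ≤ p.K →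
      Step.InInterval (theta13OfThm1CC1 F 2 ε₀ ε₂₉ B₃ B₃' a₀ a₁).γ n (gOfRecord₁₃ F 2 (theta13OfThm1CC1 F 2 ε₀ ε₂₉ B₃ B₃' a₀ a₁) p) → PartCompat₁₃ F 2 (theta13OfThm1CC1 F 2 ε₀ ε₂₉ B₃ B₃' a₀ a₁) p n → Adm (theta13OfThm1CC1 F 2 ε₀ ε₂₉ B₃ B₃' a₀ a₁).ν (theta13OfThm1CC1 F 2 ε₀ ε₂₉ B₃ B₃' a₀ a₁).τ9.M (gOfRecord₁₃ F 2 (theta13OfThm1CC1 F 2 ε₀ ε₂₉ B₃ B₃' a₀ a₁) p) p.K n s)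
    (hmono : ∀ (p : B12.RunParams) (n : ℕ), n ≤ p.K → Step.InInterval (theta13OfThm1CC1 F 2 ε₀ ε₂₉ B₃ B₃' a₀ a₁).γ n (gOfRecord₁₃ F 2 (theta13OfThm1CC1 F 2 ε₀ ε₂₉ B₃ B₃' a₀ a₁) p) → ∀ m, m < n →
      gOfRecord₁₃ F 2 (theta13OfThm1CC1 F 2 ε₀ ε₂₉ B₃ B₃' a₀ a₁) p m ≤ gOfRecord₁₃ F 2 (theta13OfThm1CC1 F 2 ε₀ ε₂₉ B₃ B₃' a₀ a₁) p (m + 1))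
    (hcompRev : ∀ (p : B12.RunParams) (n : ℕ), n ≤ p.K → Step.InInterval (theta13OfThm1CC1 F 2 ε₀ ε₂₉ B₃ B₃' a₀ a₁).γ n (gOfRecord₁₃ F 2 (theta13OfThm1CC1 F 2 ε₀ ε₂₉ B₃ B₃' a₀ a₁) p) → ∀ m, m < n →
      (theta13OfThm1CC1 F 2 ε₀ ε₂₉ B₃ B₃' a₀ a₁).s2.cR * epsOfRecord (theta13OfThm1CC1 F 2 ε₀ ε₂₉ B₃ B₃' a₀ a₁).ν (gOfRecord₁₃ F 2 (theta13OfThm1CC1 F 2 ε₀ ε₂₉ B₃ B₃' a₀ a₁) p) (m + 1) ≤ 2 * ((theta13OfThm1CC1 F 2 ε₀ ε₂₉ B₃ B₃' a₀ a₁).s2.cR * epsOfRecord (theta13OfThm1CC1 F 2 ε₀ ε₂₉ B₃ B₃' a₀ a₁).ν (gOfRecord₁₃ F 2 (theta13OfThm1CC1 F 2 ε₀ ε₂₉ B₃ B₃' a₀ a₁) p) m)) :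
    ∃ θ : Stage13RParams F 2, θ.Provisos₁₃SepCoPR F 2 ∧ (θ.ZrUnity F 2 ∧ θ.SlotsNondegenerate₁₃ F 2) ∧ θ.Admissible F 2 :=
  exists_k0SepCoPR_of_exists_k0SepCoP F (exists_k0SepCoP_of_thm1RegSepCoP7M_of_thm1Gauge F hε hε' hB hB' ha₀ ha₁ h15 h15G hAdm hmono hcompRev)

/-- **THE ⁶ IMAGE OF ★★★★★★** (β-box form; cured witness). [cite: Balaban1985Variational, (6)–(7) p.278, Thm 1 (8)–(9) p.279, (152) p.301, Prop. 8 p.304, p.304 lines 1–2; Balaban1985RegularSpaces, (1.3)–(1.9) p.77; Balaban1984PropagatorsII, (2.3) p.224; Balaban1988Convergent, Thm 1 p.262, (2.4)–(2.8) pp.255–256, (2.12)–(2.13) p.256, (2.27)–(2.28) p.259, (2.34)–(2.41) p.261, (3.16)–(3.22) pp.268–269; Balaban1987RG1, (0.1) p.251, (1.11)–(1.12) p.262; Balaban1989LargeFieldI, (0.3)–(0.4) p.176] -/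
theorem exists_k0SepCoPR_of_thm1RegSepCoP7M_of_thm1Gauge_of_betaBox (F : T4Family) (hε : 0 < ε₀) (hε' : 0 < ε₂₉) (hB : 0 ≤ B₃) (hB' : 0 ≤ B₃') (ha₀ : 0 < a₀) (ha₁ : 0 < a₁) {Adm : StepGuard F}
    (h15 : VariationalThm1RegSepCoP7MGB F 2 Adm (lamDatum F) (dataSmall7PTopOf F 2) B₃ a₀ a₁) (h15G : VariationalThm1GaugeRegSepCoP7MGB F 2 1 Adm (lamDatum F) (dataSmall7PTopOf F 2) B₃ B₃' a₀ a₁)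
    (hAdm : ∀ (p : B12.RunParams) (n : ℕ) (s : SeqOfRecord F (theta13OfThm1CC1 F 2 ε₀ ε₂₉ B₃ B₃' a₀ a₁).ν (theta13OfThm1CC1 F 2 ε₀ ε₂₉ B₃ B₃' a₀ a₁).τ9.M (gOfRecord₁₃ F 2 (theta13OfThm1CC1 F 2 ε₀ ε₂₉ B₃ B₃' a₀ a₁) p) p.K n), 1 ≤ n → n ≤ p.K →
      Step.InInterval (theta13OfThm1CC1 F 2 ε₀ ε₂₉ B₃ B₃' a₀ a₁).γ n (gOfRecord₁₃ F 2 (theta13OfThm1CC1 F 2 ε₀ ε₂₉ B₃ B₃' a₀ a₁) p) → PartCompat₁₃ F 2 (theta13OfThm1CC1 F 2 ε₀ ε₂₉ B₃ B₃' a₀ a₁) p n → Adm (theta13OfThm1CC1 F 2 ε₀ ε₂₉ B₃ B₃' a₀ a₁).ν (theta13OfThm1CC1 F 2 ε₀ ε₂₉ B₃ B₃' a₀ a₁).τ9.M (gOfRecord₁₃ F 2 (theta13OfThm1CC1 F 2 ε₀ ε₂₉ B₃ B₃' a₀ a₁) p) p.K n s)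
    {b β' : ℝ} (hb : 0 ≤ b) (hlow : FlowStep.BetaLowerH b (1 / 2) (betaOfRecord₁₃ F 2 (theta13OfThm1CC1 F 2 ε₀ ε₂₉ B₃ B₃' a₀ a₁)))
    (hup : FlowStep.BetaUpperH β' (1 / 2) (betaOfRecord₁₃ F 2 (theta13OfThm1CC1 F 2 ε₀ ε₂₉ B₃ B₃' a₀ a₁))) (hβ' : β' ≤ 3) :
    ∃ θ : Stage13RParams F 2, θ.Provisos₁₃SepCoPR F 2 ∧ (θ.ZrUnity F 2 ∧ θ.SlotsNondegenerate₁₃ F 2) ∧ θ.Admissible F 2 :=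
  exists_k0SepCoPR_of_exists_k0SepCoP F (exists_k0SepCoP_of_thm1RegSepCoP7M_of_thm1Gauge_of_betaBox F hε hε' hB hB' ha₀ ha₁ h15 h15G hAdm hb hlow hup hβ')

/-- **★★★★★★★ THE ⁶ K0 BODY KEYED ON THE ᴮ STEP FACT** — K0⁶∕K0⁷'s body for `F` from (8) `VariationalThm1RegSepCoP7MGB F 2 Adm (lamDatum F) (dataSmall7PTopOf F 2) B₃ a₀ a₁`, the (9)-step over print's datum
`Gauge9RegSepTopStepGB … 1 Adm (lamDatum F) (dataSmall7PTopOf F 2) …`, the guard at the family, the β-box leaf and the signs; cured witness.  With S1a-C's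
`variationalThm1RegSepCoP7MGB_of_prop8RegSepTopStepGB_of_zero` ∕ k0-s1-w1's 53′ (Summits side) the K0 closing term is one line over [15] Prop 8's top step over the same `(Adm, lamDatum F, Dat)`, Sect. F's
(9)-step, the β-box and the signs.  CONDITIONAL — nothing of Bałaban asserted; K0 NOT closed here. [cite: Balaban1985Variational, (6)–(7) p.278, Thm 1 (8)–(9) p.279, (152) p.301, Prop. 8 p.304, p.304 lines 1–2; Balaban1985RegularSpaces, (1.3)–(1.9) p.77; Balaban1984PropagatorsII, (2.3) p.224; Balaban1988Convergent, Thm 1 p.262, (2.4)–(2.8) pp.255–256, (2.12)–(2.13) p.256, (2.27)–(2.28) p.259, (2.34)–(2.41) p.261, (3.16)–(3.22) pp.268–269; Balaban1987RG1, (0.1) p.251, (1.11)–(1.12) p.262; Balaban1989LargeFieldI, (0.3)–(0.4) p.176] -/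
theorem exists_k0SepCoPR_of_thm1RegSepCoP7M_of_gauge9TopStep_of_betaBox (F : T4Family) (hε : 0 < ε₀) (hε' : 0 < ε₂₉) (hB : 0 ≤ B₃) (hB' : 0 ≤ B₃') (ha₀ : 0 < a₀) (ha₁ : 0 < a₁) {Adm : StepGuard F}
    (h15 : VariationalThm1RegSepCoP7MGB F 2 Adm (lamDatum F) (dataSmall7PTopOf F 2) B₃ a₀ a₁) (h9 : Gauge9RegSepTopStepGB F 2 (fun ν K Ω => suppDomOfRecord F ν K Ω) 1 Adm (lamDatum F) (dataSmall7PTopOf F 2) B₃ B₃' a₀ a₁)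
    (hAdm : ∀ (p : B12.RunParams) (n : ℕ) (s : SeqOfRecord F (theta13OfThm1CC1 F 2 ε₀ ε₂₉ B₃ B₃' a₀ a₁).ν (theta13OfThm1CC1 F 2 ε₀ ε₂₉ B₃ B₃' a₀ a₁).τ9.M (gOfRecord₁₃ F 2 (theta13OfThm1CC1 F 2 ε₀ ε₂₉ B₃ B₃' a₀ a₁) p) p.K n), 1 ≤ n → n ≤ p.K →
      Step.InInterval (theta13OfThm1CC1 F 2 ε₀ ε₂₉ B₃ B₃' a₀ a₁).γ n (gOfRecord₁₃ F 2 (theta13OfThm1CC1 F 2 ε₀ ε₂₉ B₃ B₃' a₀ a₁) p) → PartCompat₁₃ F 2 (theta13OfThm1CC1 F 2 ε₀ ε₂₉ B₃ B₃' a₀ a₁) p n → Adm (theta13OfThm1CC1 F 2 ε₀ ε₂₉ B₃ B₃' a₀ a₁).ν (theta13OfThm1CC1 F 2 ε₀ ε₂₉ B₃ B₃' a₀ a₁).τ9.M (gOfRecord₁₃ F 2 (theta13OfThm1CC1 F 2 ε₀ ε₂₉ B₃ B₃' a₀ a₁) p) p.K n s)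
    {b β' : ℝ} (hb : 0 ≤ b) (hlow : FlowStep.BetaLowerH b (1 / 2) (betaOfRecord₁₃ F 2 (theta13OfThm1CC1 F 2 ε₀ ε₂₉ B₃ B₃' a₀ a₁)))
    (hup : FlowStep.BetaUpperH β' (1 / 2) (betaOfRecord₁₃ F 2 (theta13OfThm1CC1 F 2 ε₀ ε₂₉ B₃ B₃' a₀ a₁))) (hβ' : β' ≤ 3) :
    ∃ θ : Stage13RParams F 2, θ.Provisos₁₃SepCoPR F 2 ∧ (θ.ZrUnity F 2 ∧ θ.SlotsNondegenerate₁₃ F 2) ∧ θ.Admissible F 2 :=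
  exists_k0SepCoPR_of_exists_k0SepCoP F (exists_k0SepCoP_of_thm1RegSepCoP7M_of_gauge9TopStep_of_betaBox F hε hε' hB hB' ha₀ ha₁ h15 h9 hAdm hb hlow hup hβ')

end ClosersGauge

end Literature.MathematicalPhysics.QuantumFieldTheory.Balaban1983to89.Node00

end
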